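import Summits.HodgeConjecture.CorCM.MumfordTateRankTypeIVThreefoldTimesAllCurves
import Summits.HodgeConjecture.CorCM.MumfordTateRankRigidTimesNonCMCurve
import Summits.HodgeConjecture.CorCM.MumfordTateRankRigidIsogenyInvariance
import HarnessLib

/-!
# Every product of a simple type-IV(2,1) threefold with pairwise non-isogenous elliptic curves is `Θ`-RIGID; hence `t(X × Y) ≥ t(X)` for all `Y`
# (Moonen–Zarhin 1999 §3 (3.1), (3.4), (3.6), (3.8): the projections of `Hg` are onto — for the tree's `hodgeLie`, via rigidity)

COR-CM (cell `pub-hodgecm2`, seat `b27` gen 51, count-neutral Mumford–Tate-rank ladder; theorems only, no definition, no named fact;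
UNCONDITIONAL — nothing here uses or asserts HC_CM).  Notation `t(X) = dim MT(H¹X)`.

Assembly of the gen-51 rigidity tools: the CM tower `T × ⨁E_C` is rigid (`CorCM/MumfordTateRankCMCurvesTowerRigid`), an absorbed curve of the field
`End⁰T` keeps rigidity (`CorCM/MumfordTateRankTypeIVThreefoldTimesAllCurves` §4), each non-CM curve with `Hom = 0` keeps rigidity
(`CorCM/MumfordTateRankRigidTimesNonCMCurve`), and rigidity is an isogeny invariant (`CorCM/MumfordTateRankRigidIsogenyInvariance`) — so the shape of
the product does not matter.

* §1 **`hodgeLie_rigid_prod_biproduct_nonCM_curves_of_rigid`** — `H¹A` rigid (`0 < dim A`), `E₀, …, E_m` pairwise non-isogenous non-CM curves with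
  `Hom(A, E_j) = 0` ⟹ `H¹(A × ⨁E)` rigid (induction: `A × ⨁E ∼ (A × E₀) × ⨁_{j ≥ 1} E_j`).
* §2 **`hodgeLie_rigid_of_isIsogenous_typeIV_threefold_prod_biproduct_curves`** — `T` a simple abelian threefold with `dim_ℚ End⁰T = 2`, `E₀, …, E_m`
  pairwise non-isogenous elliptic curves (CM of any field, or not): **`H¹X` is `Θ`-rigid for every `X ∼ T × ⨁E`**; hence
  **`mtRank_hodge_one_le_of_isIsogenous_typeIV_threefold_prod_biproduct_curves_prod`**: `t(X) ≤ t(Z)` for every `Z ∼ X × Y`.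

## References
* [MoonenZarhin1999LowDim] B. Moonen, Yu. G. Zarhin, *Hodge classes on abelian varieties of low dimension*, Math. Ann. 315 (1999), §3 (3.1), Lemma (3.4),
  (3.6), Prop. (3.8) [corpus: paper:arxiv-math_9901113 pp. 6–7]. [cite: MoonenZarhin1999LowDim, §3 (3.1), (3.4) and (3.8)]
* [Moonen1999MTNotes] B. Moonen, *Notes on Mumford–Tate groups* (1999), (1.7), (1.8). [cite: Moonen1999MTNotes, (1.7) and (1.8)]
* [MumfordAV1970] D. Mumford, *Abelian Varieties* (1970), §19 Thm. 1, Cor. 2. [cite: MumfordAV1970, §19 Cor. 2 of Thm. 1]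
-/

noncomputable section

open CategoryTheory CategoryTheory.Limits Module
open scoped BigOperators

namespace Summit.HodgeConjecture.CorCM

open Literature.AlgebraicGeometry.Motives
open Literature.AlgebraicGeometry.Motives.AbelianVariety
open Literature.AlgebraicGeometry.Motives.HodgeStructure
open Literature.AlgebraicGeometry.HodgeTheory
open Literature.AlgebraicGeometry.ComplexMultiplication
open Literature.AlgebraicGeometry.Milne1999 (IsOfCMType hom_eq_zero_of_isSimple_of_not_isIsogenous)

variable [HodgeTensorFacts.{0, 0}] {X T : AbelianVariety ℂ} {n : ℕ}

/-! ## §1 A rigid base times pairwise non-isogenous non-CM curves -/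

/-- **`H¹(A × ⨁_j E_j)` is `Θ`-rigid for `Θ`-rigid `H¹A` (`0 < dim A`) and pairwise non-isogenous NON-CM elliptic curves `E_j` with `Hom(A, E_j) = 0`**
(induction on the number of curves: `A × ⨁E ∼ (A × E₀) × ⨁_{j ≥ 1} E_j`, the base `A × E₀` is rigid by `CorCM/MumfordTateRankRigidTimesNonCMCurve` and
still has `Hom(A × E₀, E_j) = 0`; rigidity passes along the isogeny). [cite: MoonenZarhin1999LowDim, §3 (3.1), (3.4) and (3.8)] -/
theorem hodgeLie_rigid_prod_biproduct_nonCM_curves_of_rigid : ∀ {m : ℕ} {A : AbelianVariety ℂ} {k l : ℕ} (hA : IsSmoothProjective k A.X)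
    {E : Fin (m + 1) → AbelianVariety ℂ} (hP : IsSmoothProjective l (A.prod (⨁ E)).X) (_ : 0 < A.dim)
    (_ : haveI := BettiUniverse.finite hA 1
      ∀ 𝔞 : Submodule ℚ (Module.End ℚ (bettiCohomology A.X 1)),
        𝔞 ≤ (BettiUniverse.hodge exists_isReal_hodgeModel_holds hA 1).hodgeLie →
        (∀ B ∈ 𝔞, ∀ B' ∈ 𝔞, B * B' - B' * B ∈ 𝔞) →
        (∃ Θ ∈ Submodule.span ℂ ((fun B : Module.End ℚ (bettiCohomology A.X 1) => B.baseChange ℂ) ''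
            (𝔞 : Set (Module.End ℚ (bettiCohomology A.X 1)))),
          ∀ p, ∀ x ∈ (BettiUniverse.hodge exists_isReal_hodgeModel_holds hA 1).piece p (((1 : ℕ) : ℤ) - p),
            Θ x = ((2 * p - ((1 : ℕ) : ℤ) : ℤ) : ℂ) • x) →
        (BettiUniverse.hodge exists_isReal_hodgeModel_holds hA 1).hodgeLie ≤ 𝔞)
    (_ : ∀ j, (E j).dim = 1) (_ : ∀ j, ¬ IsOfCMType (E j)) (_ : ∀ i j, i ≠ j → ¬ IsIsogenous (E i) (E j))
    (_ : ∀ j, ∀ u : A ⟶ E j, u = 0),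
    haveI := BettiUniverse.finite hP 1
    ∀ 𝔞 : Submodule ℚ (Module.End ℚ (bettiCohomology (A.prod (⨁ E)).X 1)),
      𝔞 ≤ (BettiUniverse.hodge exists_isReal_hodgeModel_holds hP 1).hodgeLie →
      (∀ B ∈ 𝔞, ∀ B' ∈ 𝔞, B * B' - B' * B ∈ 𝔞) →
      (∃ Θ ∈ Submodule.span ℂ ((fun B : Module.End ℚ (bettiCohomology (A.prod (⨁ E)).X 1) => B.baseChange ℂ) ''
          (𝔞 : Set (Module.End ℚ (bettiCohomology (A.prod (⨁ E)).X 1)))),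
        ∀ p, ∀ x ∈ (BettiUniverse.hodge exists_isReal_hodgeModel_holds hP 1).piece p (((1 : ℕ) : ℤ) - p),
          Θ x = ((2 * p - ((1 : ℕ) : ℤ) : ℤ) : ℂ) • x) →
      (BettiUniverse.hodge exists_isReal_hodgeModel_holds hP 1).hodgeLie ≤ 𝔞
  | 0, A, k, l, hA, E, hP, hA0, hrigA, hE1, hEcm, _, hAE => by
    -- one curve: `A × ⨁E ∼ A × E₀`
    have hQ : IsSmoothProjective (A.prod (E 0)).dim (A.prod (E 0)).X := AbelianVariety.isSmoothProjective_holds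
    have hrig := hodgeLie_rigid_prod_nonCMCurve_of_rigid hA hQ hrigA (hE1 0) (hEcm 0) (hAE 0)
    have hiso : IsIsogenous (A.prod (E 0)) (A.prod (⨁ E)) :=
      (IsIsogenous.refl A).prod (isIsogenous_biproduct_of_forall_eq E 0 fun j => Fin.ext (by have := j.2; omega)).symm'
    exact hodgeLie_rigid_of_isIsogenous hQ hP hiso hrig
  | m + 1, A, k, l, hA, E, hP, hA0, hrigA, hE1, hEcm, hniso, hAE => by
    classical
    -- `A × ⨁E ∼ (A × E₀) × ⨁_{j ≥ 1} E_j`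
    obtain ⟨h, g, hhg, hgh⟩ := AndreRiemann.biproduct_succ_split E
    have hh : IsIsogeny h := isIsogeny_of_comp_eq_of_comp_eq (isIsogeny_id _) (isIsogeny_id _) hgh hhg
    have hB : IsSmoothProjective (A.prod (E 0)).dim (A.prod (E 0)).X := AbelianVariety.isSmoothProjective_holds
    have hQ : IsSmoothProjective ((A.prod (E 0)).prod (⨁ (E ∘ Fin.succ))).dim ((A.prod (E 0)).prod (⨁ (E ∘ Fin.succ))).X :=
      AbelianVariety.isSmoothProjective_holds
    have hrigB := hodgeLie_rigid_prod_nonCMCurve_of_rigid hA hB hrigA (hE1 0) (hEcm 0) (hAE 0)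
    have hBE : ∀ j, ∀ u : A.prod (E 0) ⟶ (E ∘ Fin.succ) j, u = 0 := fun j =>
      hom_prod_eq_zero_of_forall_eq_zero (hAE j.succ) fun v =>
        hom_eq_zero_of_isSimple_of_not_isIsogenous (isSimple_of_dim_le_one (hE1 0).le) (isSimple_of_dim_le_one (hE1 j.succ).le)
          (hniso 0 j.succ (Fin.succ_ne_zero j).symm) v
    have hrigQ := hodgeLie_rigid_prod_biproduct_nonCM_curves_of_rigid hB hQ (by rw [dim_prod]; omega) hrigB (fun j => hE1 j.succ)
      (fun j => hEcm j.succ) (fun i j hij => hniso i.succ j.succ fun h => hij (Fin.succ_injective _ h)) hBE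
    have hiso : IsIsogenous ((A.prod (E 0)).prod (⨁ (E ∘ Fin.succ))) (A.prod (⨁ E)) :=
      (((IsIsogenous.refl A).prod ⟨h, hh⟩).trans (Literature.AlgebraicGeometry.HodgeTheory.isIsogenous_prod_assoc A (E 0) _).symm').symm'
    exact hodgeLie_rigid_of_isIsogenous hQ hP hiso hrigQ

/-! ## §2 The type-IV threefold times any pairwise non-isogenous curves -/

/-- **`H¹X` is `Θ`-rigid for every `X ∼ T × E₀ × ⋯ × E_m`**, `T` a simple abelian threefold with `dim_ℚ End⁰T = 2` and `E₀, …, E_m` pairwise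
non-isogenous elliptic curves (CM of any field — at most one with `End⁰E_j ↪ End⁰T` — or not CM): the CM curves form a rigid tower over `T` (the one of
the field `End⁰T`, if any, absorbed), the non-CM curves are adjoined one at a time by Lemma (3.4), and rigidity passes along isogenies.
[cite: MoonenZarhin1999LowDim, §3 (3.1), (3.4), (3.6) and (3.8)] [cite: Moonen1999MTNotes, (1.7) and (1.8)] -/
theorem hodgeLie_rigid_of_isIsogenous_typeIV_threefold_prod_biproduct_curves {m : ℕ} {E : Fin (m + 1) → AbelianVariety ℂ}
    (hX : IsSmoothProjective n X.X) (hTs : T.IsSimple) (hT3 : T.dim = 3) (hTE : Module.finrank ℚ T.endAlgebra = 2)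
    (hE1 : ∀ j, (E j).dim = 1) (hniso : ∀ i j, i ≠ j → ¬ IsIsogenous (E i) (E j)) (hXP : IsIsogenous X (T.prod (⨁ E))) :
    haveI := BettiUniverse.finite hX 1
    ∀ 𝔞 : Submodule ℚ (Module.End ℚ (bettiCohomology X.X 1)),
      𝔞 ≤ (BettiUniverse.hodge exists_isReal_hodgeModel_holds hX 1).hodgeLie →
      (∀ B ∈ 𝔞, ∀ B' ∈ 𝔞, B * B' - B' * B ∈ 𝔞) →
      (∃ Θ ∈ Submodule.span ℂ ((fun B : Module.End ℚ (bettiCohomology X.X 1) => B.baseChange ℂ) ''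
          (𝔞 : Set (Module.End ℚ (bettiCohomology X.X 1)))),
        ∀ p, ∀ x ∈ (BettiUniverse.hodge exists_isReal_hodgeModel_holds hX 1).piece p (((1 : ℕ) : ℤ) - p),
          Θ x = ((2 * p - ((1 : ℕ) : ℤ) : ℤ) : ℂ) • x) →
      (BettiUniverse.hodge exists_isReal_hodgeModel_holds hX 1).hodgeLie ≤ 𝔞 := by
  classical
  have hT : IsSmoothProjective T.dim T.X := AbelianVariety.isSmoothProjective_holds
  have hrigT := hodgeLie_rigid_of_isSimple_threefold_of_finrank_endAlgebra_eq_two hT hTs hT3 hTE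
  have hTE0 : ∀ {C : AbelianVariety ℂ}, C.dim = 1 → ∀ u : T ⟶ C, u = 0 := fun hC1 u =>
    hom_eq_zero_of_isSimple_of_not_isIsogenous hTs (isSimple_of_dim_le_one hC1.le)
      (fun h => by have hd : T.dim = _ := dim_eq_of_isIsogenous_holds h; rw [hC1] at hd; omega) u
  -- the CM part of a family of CM curves over `T` is rigid, in either case of the field condition
  have hCM : ∀ {m' : ℕ} {E' : Fin (m' + 1) → AbelianVariety ℂ} {l : ℕ} (hP : IsSmoothProjective l (T.prod (⨁ E')).X),
      (∀ j, (E' j).dim = 1) → (∀ j, IsOfCMType (E' j)) → (∀ i j, i ≠ j → ¬ IsIsogenous (E' i) (E' j)) →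
      haveI := BettiUniverse.finite hP 1
      ∀ 𝔞 : Submodule ℚ (Module.End ℚ (bettiCohomology (T.prod (⨁ E')).X 1)),
        𝔞 ≤ (BettiUniverse.hodge exists_isReal_hodgeModel_holds hP 1).hodgeLie →
        (∀ B ∈ 𝔞, ∀ B' ∈ 𝔞, B * B' - B' * B ∈ 𝔞) →
        (∃ Θ ∈ Submodule.span ℂ ((fun B : Module.End ℚ (bettiCohomology (T.prod (⨁ E')).X 1) => B.baseChange ℂ) ''
            (𝔞 : Set (Module.End ℚ (bettiCohomology (T.prod (⨁ E')).X 1)))),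
          ∀ p, ∀ x ∈ (BettiUniverse.hodge exists_isReal_hodgeModel_holds hP 1).piece p (((1 : ℕ) : ℤ) - p),
            Θ x = ((2 * p - ((1 : ℕ) : ℤ) : ℤ) : ℂ) • x) →
        (BettiUniverse.hodge exists_isReal_hodgeModel_holds hP 1).hodgeLie ≤ 𝔞 := by
    intro m' E' l hP hE'1 hE'cm hE'niso
    by_cases hfor : ∀ j, IsEmpty ((E' j).endAlgebra →+* T.endAlgebra)
    · exact hodgeLie_rigid_isSimple_threefold_prod_biproduct_cmCurves hP hTs hT3 hTE hE'1 hE'cm hE'niso hfor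
    push Not at hfor
    obtain ⟨j₀, hj₀⟩ := hfor
    have hfor' : ∀ j, j ≠ j₀ → IsEmpty ((E' j).endAlgebra →+* T.endAlgebra) := by
      intro j hj
      by_contra hne
      rw [not_isEmpty_iff] at hne
      exact hE'niso j₀ j (Ne.symm hj) (isIsogenous_of_nonempty_ringHom_of_cmCurves (hE'1 j₀) (hE'cm j₀) (hE'1 j) (hE'cm j)
        (nonempty_ringHom_of_cmCurves_of_nonempty (hE'1 j₀) (hE'cm j₀) hTE hj₀ hne))
    cases m' with
    | zero =>
      -- `T × E'₀`, the absorbed curve: `t = 10 = t(T)`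
      have hQ : IsSmoothProjective (T.prod (E' j₀)).dim (T.prod (E' j₀)).X := AbelianVariety.isSmoothProjective_holds
      haveI := BettiUniverse.finite hQ 1
      haveI := BettiUniverse.finite hT 1
      have h10 := mtRank_hodge_one_eq_ten_of_isIsogenous_cmCurve_prod_isSimple_threefold_of_nonempty_ringHom hQ (hE'1 j₀) (hE'cm j₀) hTs hT3 hTE
        hj₀ (isIsogenous_prod_comm T (E' j₀))
      have h10T := (mtRank_hodge_one_of_isSimple_threefold_of_finrank_endAlgebra_eq_two hT hTs hT3 hTE).1
      have hrigQ := hodgeLie_rigid_prod_of_rigid_of_mtRank_le hT hQ (by omega) hrigT (by rw [h10, h10T])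
      exact hodgeLie_rigid_of_isIsogenous hQ hP
        ((IsIsogenous.refl T).prod (isIsogenous_biproduct_of_forall_eq E' j₀ fun j => Fin.ext (by have := j.2; have := j₀.2; omega)).symm')
        hrigQ
    | succ m'' =>
      let e : Fin (m'' + 1) ≃ {j // j ≠ j₀} := finSuccAboveEquiv j₀
      let E'' : Fin (m'' + 1) → AbelianVariety ℂ := (fun j : {j // j ≠ j₀} => E' j.1) ∘ e
      have hsub : IsIsogenous (⨁ fun j : {j // j ≠ j₀} => E' j.1) (⨁ E'') :=
        ⟨(biproduct.reindex e (fun j : {j // j ≠ j₀} => E' j.1)).inv, isIsogeny_hom_of_iso (biproduct.reindex e _).symm⟩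
      have hQ : IsSmoothProjective ((T.prod (⨁ E'')).prod (E' j₀)).dim ((T.prod (⨁ E'')).prod (E' j₀)).X :=
        AbelianVariety.isSmoothProjective_holds
      have hrigQ := (hodgeLie_rigid_and_le_mtRank_of_threefold_prod_biproduct_cmCurves_prod_sameField hQ hTs hT3 hTE (E := E'')
        (fun i => hE'1 _) (fun i => hE'cm _) (fun i i' hii' => hE'niso _ _ fun h => hii' (e.injective (Subtype.ext h)))
        (fun i => hfor' _ (e i).2) (hE'1 j₀) (hE'cm j₀) hj₀).1
      have hiso : IsIsogenous ((T.prod (⨁ E'')).prod (E' j₀)) (T.prod (⨁ E')) :=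
        (((IsIsogenous.refl T).prod ((isIsogenous_biproduct_prod_erase E' j₀).trans (hsub.prod (IsIsogenous.refl _)))).trans
          (Literature.AlgebraicGeometry.HodgeTheory.isIsogenous_prod_assoc T (⨁ E'') (E' j₀)).symm').symm'
      exact hodgeLie_rigid_of_isIsogenous hQ hP hiso hrigQ
  -- split by «CM»
  by_cases hall : ∀ j, IsOfCMType (E j)
  · have hP : IsSmoothProjective (T.prod (⨁ E)).dim (T.prod (⨁ E)).X := AbelianVariety.isSmoothProjective_holds
    exact hodgeLie_rigid_of_isIsogenous hP hX hXP.symm' (hCM hP hE1 hall hniso)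
  by_cases hnone : ∀ j, ¬ IsOfCMType (E j)
  · have hP : IsSmoothProjective (T.prod (⨁ E)).dim (T.prod (⨁ E)).X := AbelianVariety.isSmoothProjective_holds
    exact hodgeLie_rigid_of_isIsogenous hP hX hXP.symm'
      (hodgeLie_rigid_prod_biproduct_nonCM_curves_of_rigid hT hP (by omega) hrigT hE1 hnone hniso fun j => hTE0 (hE1 j))
  push Not at hall hnone
  obtain ⟨j₁, hj₁⟩ := hall
  obtain ⟨j₂, hj₂⟩ := hnone
  obtain ⟨mC, mN, EC, EN, -, -, -, -, hEC1, hEN1, hECcm, hENcm, hECniso, hENniso, hCN, hsplit⟩ :=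
    exists_split_cm_nonCM_curves hE1 hniso hj₁ hj₂
  have hA : IsSmoothProjective (T.prod (⨁ EC)).dim (T.prod (⨁ EC)).X := AbelianVariety.isSmoothProjective_holds
  have hP : IsSmoothProjective ((T.prod (⨁ EC)).prod (⨁ EN)).dim ((T.prod (⨁ EC)).prod (⨁ EN)).X := AbelianVariety.isSmoothProjective_holds
  have hAE : ∀ j, ∀ u : T.prod (⨁ EC) ⟶ EN j, u = 0 := fun j =>
    hom_prod_eq_zero_of_forall_eq_zero (hTE0 (hEN1 j)) fun v => biproduct.hom_ext' _ _ fun i => by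
      rw [comp_zero]
      exact hom_eq_zero_of_isSimple_of_not_isIsogenous (isSimple_of_dim_le_one (hEC1 i).le) (isSimple_of_dim_le_one (hEN1 j).le) (hCN i j) _
  have hrigP := hodgeLie_rigid_prod_biproduct_nonCM_curves_of_rigid hA hP (by rw [dim_prod]; omega) (hCM hA hEC1 hECcm hECniso) hEN1 hENcm
    hENniso hAE
  exact hodgeLie_rigid_of_isIsogenous hP hX
    ((hXP.trans ((IsIsogenous.refl T).prod hsplit)).trans (Literature.AlgebraicGeometry.HodgeTheory.isIsogenous_prod_assoc T (⨁ EC) (⨁ EN)).symm').symm'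
    hrigP

/-- **`t(X) ≤ t(Z)` for every `Z ∼ X × Y`**, where `X ∼ T × E₀ × ⋯ × E_m` for a simple abelian threefold `T` with `dim_ℚ End⁰T = 2` and pairwise
non-isogenous elliptic curves `E_j`, and `Y` is ARBITRARY («the projection `Hg(X × Y) → Hg(X)` is onto»).
[cite: MoonenZarhin1999LowDim, §3 (3.1)] -/
theorem mtRank_hodge_one_le_of_isIsogenous_typeIV_threefold_prod_biproduct_curves_prod {m : ℕ} {E : Fin (m + 1) → AbelianVariety ℂ}
    {Z : AbelianVariety ℂ} {nZ : ℕ} (hZ : IsSmoothProjective nZ Z.X) (hX : IsSmoothProjective n X.X) (hTs : T.IsSimple) (hT3 : T.dim = 3)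
    (hTE : Module.finrank ℚ T.endAlgebra = 2) (hE1 : ∀ j, (E j).dim = 1) (hniso : ∀ i j, i ≠ j → ¬ IsIsogenous (E i) (E j))
    (hXP : IsIsogenous X (T.prod (⨁ E))) {Y : AbelianVariety ℂ} (hZP : IsIsogenous Z (X.prod Y)) :
    haveI := BettiUniverse.finite hZ 1
    haveI := BettiUniverse.finite hX 1
    (BettiUniverse.hodge exists_isReal_hodgeModel_holds hX 1).mtRank ≤ (BettiUniverse.hodge exists_isReal_hodgeModel_holds hZ 1).mtRank := by
  have hX0 : 0 < X.dim := by
    obtain ⟨f, hf⟩ := hXP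
    rw [dim_eq_of_isIsogeny hf, dim_prod]; omega
  exact mtRank_hodge_one_le_of_isIsogenous_prod_of_rigid hZ hX hX0
    (hodgeLie_rigid_of_isIsogenous_typeIV_threefold_prod_biproduct_curves hX hTs hT3 hTE hE1 hniso hXP) hZP

end Summit.HodgeConjecture.CorCM

end
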